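import Literature.Barriers.CriticalPhenomena.SupercriticalSAWSpaceFillingTilesDeep
import Literature.Probability.RandomPlanarGeometry.SAWSpliceGeometry
import HarnessLib

/-!
# Supercritical SAW (Duminil-Copin–Kozma–Yadin 2014), Theorem 6 for the disk via odd tiles:
# geometry of the annular case (rim lemma, frames at the origin, the half-disk family)

Ingredients for the case of the proof of Theorem 6 of H. Duminil-Copin, G. Kozma, A. Yadin,
*Supercritical self-avoiding walks are space-filling*, Ann. IHP Probab. Stat. 50 (2014), §3,
that the print omits (a walk of `𝔻_δ` avoiding every deep tile): the surgery of
`SAWSpliceDefs.lean` is then performed about the ORIGIN (`z₀ = 0`, the centre of the tile `0`)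
with a sphere radius `d₀ = dist_{ℓ¹}(0, γ)` of order `1/δ`, and a structure filling a half disk.

* **Rim lemma** (`not_mem_of_isClosestSite_axis`, `not_mem_of_isClosestSite_corner`): if the
  endpoint `u` is a closest site to the boundary point `a` and sits on an axis of a frame at the
  origin at height `d₀` (resp. at `(1, d₀-1)`), then the site just beyond it radially (resp. the
  axis site at height `d₀ + 1`) is NOT in `𝔻_δ`, for `δ ≤ 1/10` (real-variable cores
  `rim_core_axis`, `rim_core_corner`). This excludes the two exceptional endpoint configurations
  `BadB`, `BadX` of the cover theorem in the annular case.
* Frames at the origin: `fr_apply_zero_origin`, `dist_meshPoint_sq`, `axis_facts`, `sq_sum_fr`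
  (`w₀² + w₁² = x² + y²` for `w = fr x y`), `sq_sum_eq_frame`, `mem_meshDomain_of_sq_le`; lane
  ordinates `fy_sub`, `fy_ctr`, `fy_add`, `abs_fy_sub_ctr_le` (general `Frame` facts kept in
  this namespace to stay clear of the upstream `Frame` API).
* Lanes and tail inside the disk: `LaneFacts.sq_sum_le_of_mem_lanes` (a lane site has
  `x² + y² ≤ lp² + lq²`, the squared norm of the anchor, for `d₀ ≥ 6`),
  `LaneFacts.mem_meshDomain_of_mem_lanes`, `LaneFacts.mem_meshDomain_of_mem_tail`,
  `TemplateFacts.sq_tail_le_sq_s₂`, `TemplateFacts.s₂_mem_of_holds` (twin of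
  `Template.g_mem_of_holds` of `SAWSpliceGeometry.lean`); and the sign of the lane ordinate on the
  lanes and tail (`TemplateFacts.fy_laneFrame_tail_nonneg`, `LaneFacts.fy_nonneg_of_mem_pathSites`).
* The half-disk family `halfFamily δ m r Rd G = {τ deep : fy_G τ ≤ -1}`: connected
  (`isGraphConnected_halfFamily`), containing `-G.ey`, avoiding `0`, of size `≥ M²` when all tiles
  with `|τ|_∞ ≤ M` are deep (`card_halfFamily_ge`), and its tiles have lane ordinate `≤ -h-1`
  (`fy_le_of_mem_tile_halfFamily`).
-/

noncomputable section

open Finset Literature.Probability.LatticeModels Literature.Probability.Percolation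
  Literature.Probability.RandomPlanarGeometry.SAW

namespace Literature.Barriers.CriticalPhenomena

namespace SupercriticalSAW

variable {m r : ℕ} {δ : ℝ} {u v : Site 2}

/-! ### The rim lemma: real-variable cores -/

/-- Core of the rim lemma on an axis: `e` a unit vector, `a` a unit vector, the point `δ d e` is
within `3δ` of `a` and no farther from `a` than `δ (d+1) e`, which lies in the open unit disk;
impossible for `0 < δ ≤ 1/10`, `d ≥ 1`. [folklore] -/
theorem rim_core_axis {δ d e0 e1 a0 a1 : ℝ} (hδ : 0 < δ) (hδ' : δ ≤ 1 / 10) (hd : 1 ≤ d)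
    (he : e0 ^ 2 + e1 ^ 2 = 1) (ha : a0 ^ 2 + a1 ^ 2 = 1)
    (hclose : (δ * (d * e0) - a0) ^ 2 + (δ * (d * e1) - a1) ^ 2 ≤ (3 * δ) ^ 2)
    (hcomp : (δ * (d * e0) - a0) ^ 2 + (δ * (d * e1) - a1) ^ 2 ≤
      (δ * ((d + 1) * e0) - a0) ^ 2 + (δ * ((d + 1) * e1) - a1) ^ 2)
    (hmem : (δ * ((d + 1) * e0)) ^ 2 + (δ * ((d + 1) * e1)) ^ 2 < 1) : False := by
  set t := e0 * a0 + e1 * a1 with ht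
  -- expansions
  have eL : (δ * (d * e0) - a0) ^ 2 + (δ * (d * e1) - a1) ^ 2 = δ ^ 2 * d ^ 2 - 2 * δ * d * t + 1 := by
    linear_combination (δ ^ 2 * d ^ 2) * he + ha
  have eR : (δ * ((d + 1) * e0) - a0) ^ 2 + (δ * ((d + 1) * e1) - a1) ^ 2 =
      δ ^ 2 * (d + 1) ^ 2 - 2 * δ * (d + 1) * t + 1 := by
    linear_combination (δ ^ 2 * (d + 1) ^ 2) * he + ha
  have eM : (δ * ((d + 1) * e0)) ^ 2 + (δ * ((d + 1) * e1)) ^ 2 = δ ^ 2 * (d + 1) ^ 2 := by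
    linear_combination (δ ^ 2 * (d + 1) ^ 2) * he
  rw [eL] at hclose hcomp; rw [eR] at hcomp; rw [eM] at hmem
  -- the comparison: `2 δ t ≤ δ² (2d+1)`; the closeness: `2 δ d t ≥ 1 + δ² d² - 9 δ²`
  have h1 : 2 * δ * t ≤ δ ^ 2 * (2 * d + 1) := by linarith
  have h2 : 1 + δ ^ 2 * d ^ 2 - 9 * δ ^ 2 ≤ 2 * δ * d * t := by linarith
  -- membership: `δ (d + 1) < 1`
  have h4 : δ * (d + 1) < 1 := by
    by_contra hcon; push Not at hcon
    have h' : 1 ≤ (δ * (d + 1)) ^ 2 := one_le_pow₀ hcon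
    have e' : (δ * (d + 1)) ^ 2 = δ ^ 2 * (d + 1) ^ 2 := by ring
    linarith
  -- combine: `1 ≤ δ² (d² + d + 9)` while `δ d < 1 - δ`
  have h5 : 1 + δ ^ 2 * d ^ 2 - 9 * δ ^ 2 ≤ d * (δ ^ 2 * (2 * d + 1)) := by
    have := mul_le_mul_of_nonneg_left h1 (by linarith : (0 : ℝ) ≤ d)
    linarith
  have h6 : δ * d < 1 - δ := by linarith
  have h0 : 0 ≤ δ * d := by positivity
  have h7 : (δ * d) * (δ * d) < (1 - δ) * (1 - δ) := mul_self_lt_mul_self h0 h6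
  have h8 : δ * (δ * d) < δ * (1 - δ) := mul_lt_mul_of_pos_left h6 hδ
  have h9 : δ * δ ≤ δ * (1 / 10) := mul_le_mul_of_nonneg_left hδ' hδ.le
  linarith [h5, h7, h8, h9]

/-- Core of the rim lemma at a corner: `e, f` orthonormal, `a` a unit vector, the point
`δ (f + (d-1) e)` is within `3δ` of `a` and no farther from `a` than `δ (f + d e)`, while
`δ (d+1) e` lies in the open unit disk; impossible for `0 < δ ≤ 1/10`, `d ≥ 2`. [folklore] -/
theorem rim_core_corner {δ d e0 e1 f0 f1 a0 a1 : ℝ} (hδ : 0 < δ) (hδ' : δ ≤ 1 / 10) (hd : 2 ≤ d)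
    (he : e0 ^ 2 + e1 ^ 2 = 1) (hf : f0 ^ 2 + f1 ^ 2 = 1) (hef : e0 * f0 + e1 * f1 = 0) (ha : a0 ^ 2 + a1 ^ 2 = 1)
    (hclose : (δ * (f0 + (d - 1) * e0) - a0) ^ 2 + (δ * (f1 + (d - 1) * e1) - a1) ^ 2 ≤ (3 * δ) ^ 2)
    (hcomp : (δ * (f0 + (d - 1) * e0) - a0) ^ 2 + (δ * (f1 + (d - 1) * e1) - a1) ^ 2 ≤
      (δ * (f0 + d * e0) - a0) ^ 2 + (δ * (f1 + d * e1) - a1) ^ 2)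
    (hmem : (δ * ((d + 1) * e0)) ^ 2 + (δ * ((d + 1) * e1)) ^ 2 < 1) : False := by
  set t := e0 * a0 + e1 * a1 with ht
  set s := f0 * a0 + f1 * a1 with hs
  -- Cauchy–Schwarz for `s`
  have hs1 : s ≤ 1 := by
    have : s ^ 2 ≤ 1 := by nlinarith [sq_nonneg (f0 * a1 - f1 * a0)]
    nlinarith
  -- expansions
  have eL : (δ * (f0 + (d - 1) * e0) - a0) ^ 2 + (δ * (f1 + (d - 1) * e1) - a1) ^ 2 =
      δ ^ 2 + δ ^ 2 * (d - 1) ^ 2 - 2 * δ * s - 2 * δ * (d - 1) * t + 1 := by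
    linear_combination (δ ^ 2) * hf + (δ ^ 2 * (d - 1) ^ 2) * he + (2 * δ ^ 2 * (d - 1)) * hef + ha
  have eR : (δ * (f0 + d * e0) - a0) ^ 2 + (δ * (f1 + d * e1) - a1) ^ 2 =
      δ ^ 2 + δ ^ 2 * d ^ 2 - 2 * δ * s - 2 * δ * d * t + 1 := by
    linear_combination (δ ^ 2) * hf + (δ ^ 2 * d ^ 2) * he + (2 * δ ^ 2 * d) * hef + ha
  have eM : (δ * ((d + 1) * e0)) ^ 2 + (δ * ((d + 1) * e1)) ^ 2 = δ ^ 2 * (d + 1) ^ 2 := by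
    linear_combination (δ ^ 2 * (d + 1) ^ 2) * he
  rw [eL] at hclose hcomp; rw [eR] at hcomp; rw [eM] at hmem
  have hs2 : δ * s ≤ δ := by
    have := mul_le_mul_of_nonneg_left hs1 hδ.le
    linarith
  have h1 : 2 * δ * t ≤ δ ^ 2 * (2 * d - 1) := by linarith
  have h2 : 1 + δ ^ 2 * (d - 1) ^ 2 - 8 * δ ^ 2 - 2 * δ ≤ 2 * δ * (d - 1) * t := by linarith
  have h4 : δ * (d + 1) < 1 := by
    by_contra hcon; push Not at hcon
    have h' : 1 ≤ (δ * (d + 1)) ^ 2 := one_le_pow₀ hcon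
    have e' : (δ * (d + 1)) ^ 2 = δ ^ 2 * (d + 1) ^ 2 := by ring
    linarith
  have h5 : 1 - 2 * δ - 8 * δ ^ 2 ≤ δ ^ 2 * d ^ 2 - δ ^ 2 * d := by
    have := mul_le_mul_of_nonneg_left h1 (by linarith : (0 : ℝ) ≤ d - 1)
    linarith
  have h6 : δ * d < 1 - δ := by linarith
  have h7 : 0 ≤ δ * d - δ := by
    have : 0 ≤ δ * (d - 1) := mul_nonneg hδ.le (by linarith)
    linarith
  have h8 : (δ * d) * (δ * d - δ) < (1 - δ) * (1 - 2 * δ) := by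
    have h9 : δ * d - δ < 1 - 2 * δ := by linarith
    have h10 : 0 ≤ δ * d := by positivity
    calc (δ * d) * (δ * d - δ) ≤ (δ * d) * (1 - 2 * δ) := mul_le_mul_of_nonneg_left h9.le h10
      _ < (1 - δ) * (1 - 2 * δ) := mul_lt_mul_of_pos_right h6 (by linarith)
  have h11 : δ * δ ≤ δ * (1 / 10) := mul_le_mul_of_nonneg_left hδ' hδ.le
  linarith [h5, h8, h11]

/-! ### Frames at the origin and mesh points -/

/-- Squared distances from a mesh point in coordinates. [folklore] -/
theorem dist_meshPoint_sq (δ : ℝ) (w : Site 2) (a : ℂ) :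
    dist (meshPoint δ w) a ^ 2 = (δ * w 0 - a.re) ^ 2 + (δ * w 1 - a.im) ^ 2 := by
  rw [Complex.dist_eq, Complex.sq_norm, Complex.normSq_apply]
  simp only [Complex.sub_re, Complex.sub_im, meshPoint_re, meshPoint_im]
  ring

/-- The axis vectors of a frame: unit and orthogonal (as real numbers). [folklore] -/
theorem axis_facts (F : Frame) :
    ((F.ey 0 : ℤ) : ℝ) ^ 2 + ((F.ey 1 : ℤ) : ℝ) ^ 2 = 1 ∧ ((F.ex 0 : ℤ) : ℝ) ^ 2 + ((F.ex 1 : ℤ) : ℝ) ^ 2 = 1 ∧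
      ((F.ey 0 : ℤ) : ℝ) * F.ex 0 + ((F.ey 1 : ℤ) : ℝ) * F.ex 1 = 0 := by
  rcases F.valid with ⟨h1, h2 | h2⟩ | ⟨h1, h2 | h2⟩ | ⟨h1, h2 | h2⟩ | ⟨h1, h2 | h2⟩ <;>
    simp [h1, h2, pt_apply_zero, pt_apply_one]

/-- Coordinates of `fr` for a frame at the origin. [folklore] -/
theorem fr_apply_zero_origin (F : Frame) (hz : F.z₀ = 0) (a b : ℤ) (i : Fin 2) :
    F.fr a b i = a * F.ex i + b * F.ey i := by
  rw [Frame.fr_apply, hz]; simp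

/-- **Rim lemma on an axis.** If `u = fr 0 d₀` in a frame at the origin is a closest site to a
boundary point `a`, `d₀ ≥ 1`, `0 < δ ≤ 1/10`, then `fr 0 (d₀+1) ∉ 𝔻_δ`.
[cite: DuminilCopinKozmaYadin2014, §1 (a_δ closest to a)] -/
theorem not_mem_of_isClosestSite_axis (hδ : 0 < δ) (hδ' : δ ≤ 1 / 10) {a : ℂ} (ha : ‖a‖ = 1)
    (G : Frame) (hG : G.z₀ = 0) {d₀ : ℤ} (hd : 1 ≤ d₀) (hu : IsClosestSite unitDisk δ a (G.fr 0 d₀)) :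
    G.fr 0 (d₀ + 1) ∉ meshDomain unitDisk δ := by
  intro hmem
  obtain ⟨he, -, -⟩ := axis_facts G
  have ha' : a.re ^ 2 + a.im ^ 2 = 1 := by
    have := Complex.sq_norm a; rw [ha, Complex.normSq_apply] at this; nlinarith [this]
  have hclose := hu.dist_le hδ (by linarith) ha
  have hclose2 : dist (meshPoint δ (G.fr 0 d₀)) a ^ 2 ≤ (3 * δ) ^ 2 :=
    pow_le_pow_left₀ dist_nonneg hclose 2
  have hcomp := hu.2 _ hmem
  have hcomp2 : dist (meshPoint δ (G.fr 0 d₀)) a ^ 2 ≤ dist (meshPoint δ (G.fr 0 (d₀ + 1))) a ^ 2 :=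
    pow_le_pow_left₀ dist_nonneg hcomp 2
  rw [mem_meshDomain_unitDisk] at hmem
  have hmem2 : ‖meshPoint δ (G.fr 0 (d₀ + 1))‖ ^ 2 < 1 := by
    have := hmem; nlinarith [norm_nonneg (meshPoint δ (G.fr 0 (d₀ + 1)))]
  rw [Complex.sq_norm, Complex.normSq_apply, meshPoint_re, meshPoint_im] at hmem2
  rw [dist_meshPoint_sq, dist_meshPoint_sq] at hcomp2
  rw [dist_meshPoint_sq] at hclose2
  simp only [fr_apply_zero_origin G hG, Int.cast_add, Int.cast_mul, zero_mul, zero_add,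
    Int.cast_one] at hclose2 hcomp2 hmem2
  have hd' : (1 : ℝ) ≤ (d₀ : ℝ) := by exact_mod_cast hd
  refine rim_core_axis (d := (d₀ : ℝ)) (e0 := ((G.ey 0 : ℤ) : ℝ)) (e1 := ((G.ey 1 : ℤ) : ℝ)) hδ hδ' hd' he ha'
    ?_ ?_ ?_
  · convert hclose2 using 2
  · convert hcomp2 using 2
  · convert hmem2 using 2 <;> ring

/-- **Rim lemma at a corner.** If `u = fr 1 (d₀-1)` in a frame at the origin is a closest site
to a boundary point `a`, `fr 1 d₀ ∈ 𝔻_δ`, `d₀ ≥ 2`, `0 < δ ≤ 1/10`, then `fr 0 (d₀+1) ∉ 𝔻_δ`.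
[cite: DuminilCopinKozmaYadin2014, §1 (a_δ closest to a)] -/
theorem not_mem_of_isClosestSite_corner (hδ : 0 < δ) (hδ' : δ ≤ 1 / 10) {a : ℂ} (ha : ‖a‖ = 1)
    (G : Frame) (hG : G.z₀ = 0) {d₀ : ℤ} (hd : 2 ≤ d₀) (hu : IsClosestSite unitDisk δ a (G.fr 1 (d₀ - 1)))
    (hE : G.fr 1 d₀ ∈ meshDomain unitDisk δ) : G.fr 0 (d₀ + 1) ∉ meshDomain unitDisk δ := by
  intro hmem
  obtain ⟨he, hf, hef⟩ := axis_facts G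
  have ha' : a.re ^ 2 + a.im ^ 2 = 1 := by
    have := Complex.sq_norm a; rw [ha, Complex.normSq_apply] at this; nlinarith [this]
  have hclose := hu.dist_le hδ (by linarith) ha
  have hclose2 : dist (meshPoint δ (G.fr 1 (d₀ - 1))) a ^ 2 ≤ (3 * δ) ^ 2 :=
    pow_le_pow_left₀ dist_nonneg hclose 2
  have hcomp := hu.2 _ hE
  have hcomp2 : dist (meshPoint δ (G.fr 1 (d₀ - 1))) a ^ 2 ≤ dist (meshPoint δ (G.fr 1 d₀)) a ^ 2 :=
    pow_le_pow_left₀ dist_nonneg hcomp 2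
  rw [mem_meshDomain_unitDisk] at hmem
  have hmem2 : ‖meshPoint δ (G.fr 0 (d₀ + 1))‖ ^ 2 < 1 := by
    have := hmem; nlinarith [norm_nonneg (meshPoint δ (G.fr 0 (d₀ + 1)))]
  rw [Complex.sq_norm, Complex.normSq_apply, meshPoint_re, meshPoint_im] at hmem2
  rw [dist_meshPoint_sq, dist_meshPoint_sq] at hcomp2
  rw [dist_meshPoint_sq] at hclose2
  simp only [fr_apply_zero_origin G hG, Int.cast_add, Int.cast_mul, zero_mul, zero_add,
    Int.cast_one, one_mul, Int.cast_sub] at hclose2 hcomp2 hmem2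
  have hd' : (2 : ℝ) ≤ (d₀ : ℝ) := by exact_mod_cast hd
  refine rim_core_corner (d := (d₀ : ℝ)) (e0 := ((G.ey 0 : ℤ) : ℝ)) (e1 := ((G.ey 1 : ℤ) : ℝ))
    (f0 := ((G.ex 0 : ℤ) : ℝ)) (f1 := ((G.ex 1 : ℤ) : ℝ)) hδ hδ' hd' he hf hef ha' ?_ ?_ ?_
  · convert hclose2 using 2
  · convert hcomp2 using 2
  · convert hmem2 using 2 <;> ring

/-- **The exceptional endpoint configurations do not occur in the annular case**: for a walk of
`𝔻_δ` from a closest site `u` to `a` (`‖a‖ = 1`) to a closest site `v` to `b` (`‖b‖ = 1`), with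
`0 < δ ≤ 1/10` and `d₀ ≥ 2`, neither `BadB` nor `BadX` holds in any frame at the origin.
[cite: DuminilCopinKozmaYadin2014, §3 (proof of Proposition 7: existence of the link)] -/
theorem not_bad_of_isClosestSite (hδ : 0 < δ) (hδ' : δ ≤ 1 / 10) {a b : ℂ} (ha : ‖a‖ = 1) (hb : ‖b‖ = 1)
    (hu : IsClosestSite unitDisk δ a u) (hv : IsClosestSite unitDisk δ b v)
    {l : List (Site 2)} (hhead : l.head? = some u) (hlast : l.getLast? = some v)
    (hl : ∀ w ∈ l, w ∈ meshDomain unitDisk δ) (G : Frame) (hG : G.z₀ = 0) {d₀ : ℤ} (hd : 2 ≤ d₀) :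
    ¬BadB G d₀ l ∧ ¬BadX G d₀ l := by
  constructor
  · rintro ⟨hend, hN⟩
    have hN' := hl _ hN
    rcases hend with h | h
    · rw [hhead] at h; simp only [Option.some.injEq] at h; subst h
      exact not_mem_of_isClosestSite_axis hδ hδ' ha G hG (by omega) hu hN'
    · rw [hlast] at h; simp only [Option.some.injEq] at h; subst h
      exact not_mem_of_isClosestSite_axis hδ hδ' hb G hG (by omega) hv hN'
  · rintro ⟨-, hE, hN, hend⟩
    have hN' := hl _ hN
    have hE' := hl _ hE
    rcases hend with h | h
    · rw [hhead] at h; simp only [Option.some.injEq] at h; subst h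
      exact not_mem_of_isClosestSite_corner hδ hδ' ha G hG hd hu hE' hN'
    · rw [hlast] at h; simp only [Option.some.injEq] at h; subst h
      exact not_mem_of_isClosestSite_corner hδ hδ' hb G hG hd hv hE' hN'

/-! ### Squared norms in frame coordinates -/

/-- For a frame at the origin, `w₀² + w₁² = x² + y²` for `w = fr x y`. [folklore] -/
theorem sq_sum_fr (F : Frame) (hz : F.z₀ = 0) (x y : ℤ) :
    (F.fr x y 0) ^ 2 + (F.fr x y 1) ^ 2 = x ^ 2 + y ^ 2 := by
  simp only [Frame.fr_apply, hz, Pi.zero_apply, zero_add]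
  rcases F.valid with ⟨h1, h2 | h2⟩ | ⟨h1, h2 | h2⟩ | ⟨h1, h2 | h2⟩ | ⟨h1, h2 | h2⟩ <;>
    simp [h1, h2, pt_apply_zero, pt_apply_one] <;> ring

/-- For a frame at the origin, `w₀² + w₁² = (fx w)² + (fy w)²`. [folklore] -/
theorem sq_sum_eq_frame (F : Frame) (hz : F.z₀ = 0) (w : Site 2) :
    (w 0) ^ 2 + (w 1) ^ 2 = (F.fx w) ^ 2 + (F.fy w) ^ 2 := by
  conv_lhs => rw [← F.fr_fx_fy w]
  exact sq_sum_fr F hz _ _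

/-- A site whose frame-coordinate squared norm is at most that of a site of `𝔻_δ` is in `𝔻_δ`
(frame at the origin). [folklore] -/
theorem mem_meshDomain_of_sq_le (F : Frame) (hz : F.z₀ = 0) {w g : Site 2} (hg : g ∈ meshDomain unitDisk δ)
    (h : (F.fx w) ^ 2 + (F.fy w) ^ 2 ≤ (F.fx g) ^ 2 + (F.fy g) ^ 2) : w ∈ meshDomain unitDisk δ := by
  rw [meshDomain_unitDisk] at hg ⊢
  refine mem_meshVertices_unitDisk_of_sq_le hg ?_
  rw [Fin.sum_univ_two, Fin.sum_univ_two]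
  have h' : (w 0) ^ 2 + (w 1) ^ 2 ≤ (g 0) ^ 2 + (g 1) ^ 2 := by
    rw [sq_sum_eq_frame F hz w, sq_sum_eq_frame F hz g]; exact h
  exact_mod_cast h'

/-! ### The template about the origin: tail and `s₂` -/

namespace TemplateFacts

open Literature.Probability.RandomPlanarGeometry.SAW.Template

/-- `s₂` is a vertex of any walk to which the template applies. [folklore] -/
theorem s₂_mem_of_holds (T : Template) {l : List (Site 2)} (h : T.Holds l) : T.s₂ ∈ l := by
  rcases h.1 with ⟨s, t, hl⟩ | ⟨s, t, hl⟩ <;> rw [← hl] <;> simp [Template.seg]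

/-- Tail sites have squared frame norm at most that of `s₂` (for a well-formed template).
[folklore] -/
theorem sq_tail_le_sq_s₂ (T : Template) {d₀ : ℤ} (hd : 1 ≤ d₀) (hWF : T.WF d₀) {w : Site 2} (hw : w ∈ T.tail) :
    (T.F.fx w) ^ 2 + (T.F.fy w) ^ 2 ≤ (T.F.fx T.s₂) ^ 2 + (T.F.fy T.s₂) ^ 2 := by
  cases hs : T.shape <;> simp only [Template.tail, hs, List.mem_singleton, List.not_mem_nil] at hw <;>
    subst hw <;> simp only [Template.WF, hs] at hWF <;>
    simp only [Template.s₂, hs, Frame.fx_fr, Frame.fy_fr] <;> nlinarith [hWF.1, hWF.2]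

/-- Tail sites have non-negative lane ordinate (for a well-formed template with `d₀ ≥ 1`).
[folklore] -/
theorem fy_laneFrame_tail_nonneg (T : Template) {d₀ : ℤ} (hd : 1 ≤ d₀) (hWF : T.WF d₀) {w : Site 2}
    (hw : w ∈ T.tail) : 0 ≤ (Splice.laneFrame T).fy w := by
  unfold Splice.laneFrame
  cases hs : T.shape <;> simp only [Template.tail, hs, List.mem_singleton, List.not_mem_nil] at hw <;>
    subst hw <;> simp only [Template.WF, hs] at hWF <;> split_ifs <;>
    simp only [Frame.fy_fr, Frame.fy_swap, Frame.fx_fr] <;> omega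

end TemplateFacts

/-! ### Lane sites inside the disk -/

namespace LaneFacts

open Literature.Probability.RandomPlanarGeometry.SAW.Splice

/-- **A lane site has squared lane-frame norm at most that of the anchor**: with `(x, y)` its
lane coordinates, `x² + y² ≤ lp² + lq²` (uses `x ≤ lp + 1 ⇒ y ≤ lq - 2`, `lp ≤ lq`, `lq ≥ 3`).
[folklore] -/
theorem sq_sum_le_of_mem_lanes (X : Data m r) (hd6 : 6 ≤ X.d₀) {w : Site 2} (hw : w ∈ X.LD.laneL ∨ w ∈ X.LD.laneR) :
    ((laneFrame X.T).fx w) ^ 2 + ((laneFrame X.T).fy w) ^ 2 ≤ (lp X.T) ^ 2 + (lq X.T) ^ 2 := by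
  have hd := X.three_le_d₀
  obtain ⟨b1, b2, b3, b4, b5, b6⟩ := lp_lq_bounds X.T (by omega) X.wf
  have hyu := X.LD.hyu
  have bounds : 0 ≤ (laneFrame X.T).fx w ∧ (laneFrame X.T).fx w ≤ lα X.T + 1 ∧ 0 ≤ (laneFrame X.T).fy w ∧
      (laneFrame X.T).fy w ≤ lβ X.T + 1 ∧ (laneFrame X.T).fx w + (laneFrame X.T).fy w ≤ lα X.T + lβ X.T + 1 := by
    rcases hw with hw | hw
    · obtain ⟨h1, h2, h3, h4, h5, -⟩ := X.LD.mem_laneL hw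
      simp only [Data.LD] at h1 h2 h3 h4 h5 hyu
      exact ⟨h1, by omega, by omega, h4, h5⟩
    · obtain ⟨h1, h2, h3, h4, h5, -⟩ := X.LD.mem_laneR hw
      simp only [Data.LD] at h1 h2 h3 h4 h5 hyu
      exact ⟨by omega, h2, by omega, by omega, h5⟩
  obtain ⟨c1, c2, c3, c4, c5⟩ := bounds
  have hsum := lα_add_lβ X.T X.wf
  by_cases hx : (laneFrame X.T).fx w ≤ lp X.T
  · have e1 : ((laneFrame X.T).fx w) ^ 2 ≤ (lp X.T) ^ 2 := by nlinarith
    have e2 : ((laneFrame X.T).fy w) ^ 2 ≤ (lq X.T) ^ 2 := by nlinarith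
    linarith
  · have hx' : (laneFrame X.T).fx w = lp X.T + 1 := by omega
    have hy' : (laneFrame X.T).fy w ≤ lq X.T - 2 := by omega
    have hlq : 2 * lp X.T + 5 ≤ 4 * lq X.T := by omega
    have e2 : ((laneFrame X.T).fy w) ^ 2 ≤ (lq X.T - 2) ^ 2 := by nlinarith
    rw [hx']
    nlinarith

/-- Hence lane sites about the origin lie in `𝔻_δ` as soon as the anchor does. [folklore] -/
theorem mem_meshDomain_of_mem_lanes (X : Data m r) (hd6 : 6 ≤ X.d₀) (hz : X.T.F.z₀ = 0) {w : Site 2}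
    (hw : w ∈ X.LD.laneL ∨ w ∈ X.LD.laneR) (hg : X.T.g ∈ meshDomain unitDisk δ) : w ∈ meshDomain unitDisk δ := by
  have hzL : (laneFrame X.T).z₀ = 0 := by rw [laneFrame_z₀, hz]
  refine mem_meshDomain_of_sq_le (laneFrame X.T) hzL hg ?_
  have := sq_sum_le_of_mem_lanes X hd6 hw
  rw [laneFrame_g X.T, Frame.fx_fr, Frame.fy_fr]
  exact this

/-- Tail sites about the origin lie in `𝔻_δ` as soon as `s₂` does. [folklore] -/
theorem mem_meshDomain_of_mem_tail (X : Data m r) (hz : X.T.F.z₀ = 0) {w : Site 2} (hw : w ∈ X.T.tail)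
    (hs : X.T.s₂ ∈ meshDomain unitDisk δ) : w ∈ meshDomain unitDisk δ :=
  mem_meshDomain_of_sq_le X.T.F hz hs (TemplateFacts.sq_tail_le_sq_s₂ X.T (by have := X.three_le_d₀; omega) X.wf hw)

/-- **Sites of the lanes and the tail have non-negative lane ordinate.** [folklore] -/
theorem fy_nonneg_of_mem_pathSites (X : Data m r) {w : Site 2} (hw : w ∈ X.pathSites) :
    0 ≤ (laneFrame X.T).fy w := by
  rw [X.mem_pathSites] at hw
  have hyu := X.LD.hyu
  rcases hw with hw | hw | hw
  · obtain ⟨-, -, h3, -⟩ := X.LD.mem_laneL hw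
    simp only [Data.LD] at h3 hyu; omega
  · obtain ⟨-, -, h3, -⟩ := X.LD.mem_laneR hw
    simp only [Data.LD] at h3 hyu; omega
  · exact TemplateFacts.fy_laneFrame_tail_nonneg X.T (by have := X.three_le_d₀; omega) X.wf hw

end LaneFacts

/-! ### Lane ordinates of tiles -/

/-- `fy` is additive: `fy w - fy w' = Σ (wₖ - w'ₖ) eyₖ`. [folklore] -/
theorem fy_sub (F : Frame) (w w' : Site 2) :
    F.fy w - F.fy w' = (w 0 - w' 0) * F.ey 0 + (w 1 - w' 1) * F.ey 1 := by
  simp only [Frame.fy]; ring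

/-- Sites of a tile have lane ordinate within `h` of that of the centre. [folklore] -/
theorem abs_fy_sub_ctr_le (F : Frame) {τ w : Site 2} (hw : w ∈ OddTile.tile m r τ) :
    |F.fy w - F.fy (OddTile.ctr m r τ)| ≤ OddTile.hw m r := by
  rw [fy_sub F]
  have h := OddTile.mem_tile_iff.1 hw
  have h0 := h 0; have h1 := h 1
  simp only [OddTile.ctr_apply]
  rcases F.valid with ⟨-, h2 | h2⟩ | ⟨-, h2 | h2⟩ | ⟨-, h2 | h2⟩ | ⟨-, h2 | h2⟩ <;>
    simp only [h2, pt_apply_zero, pt_apply_one, mul_one, mul_zero, mul_neg, add_zero, zero_add, abs_le] <;>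
    constructor <;> omega

/-- For a frame at the origin, the lane ordinate of a tile centre is `L` times that of its index.
[folklore] -/
theorem fy_ctr (F : Frame) (hz : F.z₀ = 0) (τ : Site 2) :
    F.fy (OddTile.ctr m r τ) = OddTile.side m r * F.fy τ := by
  simp only [Frame.fy, hz, Pi.zero_apply, sub_zero, OddTile.ctr_apply]; ring

/-! ### The half-disk family -/

/-- The half-disk family of a frame at the origin: the deep tiles of negative lane ordinate
(project device for the case of the proof of Theorem 6 that the print omits: the family of
tiles carrying the merged polygons). [cite: DuminilCopinKozmaYadin2014, §3 (proof of Theorem 6: the maximal family of boxes)] -/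
def halfFamily (δ : ℝ) (m r Rd : ℕ) (G : Frame) : Finset (Site 2) :=
  (deepTiles δ m r Rd).filter fun τ => G.fy τ ≤ -1

/-- Membership in the half-disk family. [folklore] -/
theorem mem_halfFamily (hδ : 0 < δ) {Rd : ℕ} {G : Frame} {τ : Site 2} :
    τ ∈ halfFamily δ m r Rd G ↔ IsDeepTile δ m r Rd τ ∧ G.fy τ ≤ -1 := by
  rw [halfFamily, Finset.mem_filter, mem_deepTiles hδ]

/-- The origin tile is not in the half-disk family. [folklore] -/
theorem zero_not_mem_halfFamily (hδ : 0 < δ) {Rd : ℕ} {G : Frame} (hz : G.z₀ = 0) :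
    (0 : Site 2) ∉ halfFamily δ m r Rd G := by
  rw [mem_halfFamily hδ]
  rintro ⟨-, h⟩
  simp [Frame.fy, hz] at h

/-- Sites of tiles of the half-disk family have lane ordinate `≤ -h - 1 < 0`. [folklore] -/
theorem fy_le_of_mem_tile_halfFamily (hδ : 0 < δ) {Rd : ℕ} {G : Frame} (hz : G.z₀ = 0) {τ w : Site 2}
    (hτ : τ ∈ halfFamily δ m r Rd G) (hw : w ∈ OddTile.tile m r τ) : G.fy w ≤ -(OddTile.hw m r : ℤ) - 1 := by
  have h1 := ((mem_halfFamily hδ).1 hτ).2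
  have h2 := abs_fy_sub_ctr_le G hw
  rw [fy_ctr G hz, abs_le] at h2
  have hL := OddTile.side_eq (m := m) (r := r)
  nlinarith [h2.2, OddTile.side_pos (m := m) (r := r)]

/-- The lane ordinate of `τ ± eₖ` for the axis `k` orthogonal to `ey` is that of `τ`, and along
`ey` it moves by one: for a frame, `fy (τ + e) = fy τ + (e₀ ey₀ + e₁ ey₁)`. [folklore] -/
theorem fy_add (F : Frame) (τ e : Site 2) :
    F.fy (τ + e) = F.fy τ + (e 0 * F.ey 0 + e 1 * F.ey 1) := by
  simp only [Frame.fy, Pi.add_apply]; ring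

/-- **The half-disk family is connected.** From any of its tiles, shrinking first the coordinate
orthogonal to `ey` and then the one along `ey` leads inside the family to the tile `-ey`.
[cite: DuminilCopinKozmaYadin2014, §3 (connected families of boxes)] -/
theorem isGraphConnected_halfFamily (hδ : 0 < δ) {Rd : ℕ} (G : Frame) (hz : G.z₀ = 0)
    (hbase : -G.ey ∈ halfFamily δ m r Rd G) : IsGraphConnected (zdGraph 2) (halfFamily δ m r Rd G) := by
  classical
  set F := halfFamily δ m r Rd G with hF
  -- the axis of `ey`
  obtain ⟨i, σ, hσ, hey⟩ : ∃ (i : Fin 2) (σ : ℤ), (σ = 1 ∨ σ = -1) ∧ G.ey = σ • Pi.single i 1 := by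
    rcases G.valid with ⟨-, h2 | h2⟩ | ⟨-, h2 | h2⟩ | ⟨-, h2 | h2⟩ | ⟨-, h2 | h2⟩ <;> rw [h2]
    · exact ⟨1, 1, Or.inl rfl, by ext k; fin_cases k <;> simp⟩
    · exact ⟨1, -1, Or.inr rfl, by ext k; fin_cases k <;> simp⟩
    · exact ⟨1, 1, Or.inl rfl, by ext k; fin_cases k <;> simp⟩
    · exact ⟨1, -1, Or.inr rfl, by ext k; fin_cases k <;> simp⟩
    · exact ⟨0, 1, Or.inl rfl, by ext k; fin_cases k <;> simp⟩
    · exact ⟨0, -1, Or.inr rfl, by ext k; fin_cases k <;> simp⟩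
    · exact ⟨0, 1, Or.inl rfl, by ext k; fin_cases k <;> simp⟩
    · exact ⟨0, -1, Or.inr rfl, by ext k; fin_cases k <;> simp⟩
  have hfy : ∀ τ : Site 2, G.fy τ = σ * τ i := fun τ => by
    simp only [Frame.fy, hz, Pi.zero_apply, sub_zero, hey, Pi.smul_apply, smul_eq_mul]
    fin_cases i <;> simp <;> ring
  -- the other axis
  obtain ⟨j, hji⟩ : ∃ j : Fin 2, j ≠ i := ⟨i + 1, by fin_cases i <;> decide⟩
  have hjj : ∀ k : Fin 2, k = i ∨ k = j := fun k => by
    fin_cases i <;> fin_cases j <;> fin_cases k <;> simp_all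
  have hadj_add : ∀ (τ : Site 2) (k : Fin 2), (zdGraph 2).Adj τ (τ + Pi.single k 1) := fun τ k =>
    (zdGraph_adj_iff _ _).2 ⟨k, Or.inl rfl⟩
  have hadj_sub : ∀ (τ : Site 2) (k : Fin 2), (zdGraph 2).Adj τ (τ - Pi.single k 1) := fun τ k =>
    (zdGraph_adj_iff _ _).2 ⟨k, Or.inr (by simp)⟩
  have hmemF : ∀ {τ}, τ ∈ F ↔ IsDeepTile δ m r Rd τ ∧ σ * τ i ≤ -1 := by
    intro τ; rw [hF, mem_halfFamily hδ, hfy]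
  -- every member is joined inside `F` to the base `-ey`
  have key : ∀ n : ℕ, ∀ τ : Site 2, (τ j).natAbs + (τ i).natAbs = n → τ ∈ F →
      Relation.ReflTransGen (fun x y => (zdGraph 2).Adj x y ∧ x ∈ F ∧ y ∈ F) τ (-G.ey) := by
    intro n
    induction n using Nat.strong_induction_on with
    | _ n ih =>
      intro τ hn hτ
      obtain ⟨hdeep, hneg⟩ := hmemF.1 hτ
      by_cases hj0 : τ j = 0
      · -- shrink along `ey`
        by_cases hbase' : σ * τ i = -1
        · have : τ = -G.ey := by
            ext k
            rcases hjj k with rfl | rfl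
            · simp only [hey, Pi.neg_apply, Pi.smul_apply, Pi.single_eq_same, smul_eq_mul, mul_one]
              rcases hσ with rfl | rfl <;> omega
            · simp [hey, Pi.single_eq_of_ne hji, hj0]
          rw [this]
        · -- one step towards the origin along `i`
          have hlt : σ * τ i ≤ -2 := by omega
          rcases hσ with rfl | rfl
          · -- `τ i ≤ -2 < 0`: step `+ eᵢ`
            have hi0 : τ i < 0 := by omega
            have hτ' : τ + Pi.single i 1 ∈ F := hmemF.2 ⟨hdeep.add_single hi0, by simp; omega⟩
            refine Relation.ReflTransGen.head ⟨hadj_add τ i, hτ, hτ'⟩ (ih _ ?_ _ rfl hτ')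
            rw [← hn]; simp [Pi.single_eq_of_ne hji]; omega
          · have hi0 : 0 < τ i := by omega
            have hτ' : τ - Pi.single i 1 ∈ F := hmemF.2 ⟨hdeep.sub_single hi0, by simp; omega⟩
            refine Relation.ReflTransGen.head ⟨hadj_sub τ i, hτ, hτ'⟩ (ih _ ?_ _ rfl hτ')
            rw [← hn]; simp [Pi.single_eq_of_ne hji]; omega
      · -- shrink the orthogonal coordinate
        rcases lt_or_gt_of_ne hj0 with hneg' | hpos
        · have hτ' : τ + Pi.single j 1 ∈ F := hmemF.2 ⟨hdeep.add_single hneg', by simp [Pi.single_eq_of_ne hji.symm]; exact hneg⟩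
          refine Relation.ReflTransGen.head ⟨hadj_add τ j, hτ, hτ'⟩ (ih _ ?_ _ rfl hτ')
          rw [← hn]; simp [Pi.single_eq_of_ne hji.symm]; omega
        · have hτ' : τ - Pi.single j 1 ∈ F := hmemF.2 ⟨hdeep.sub_single hpos, by simp [Pi.single_eq_of_ne hji.symm]; exact hneg⟩
          refine Relation.ReflTransGen.head ⟨hadj_sub τ j, hτ, hτ'⟩ (ih _ ?_ _ rfl hτ')
          rw [← hn]; simp [Pi.single_eq_of_ne hji.symm]; omega
  -- symmetric relation: paths from the base
  have hsymm : ∀ x y, Relation.ReflTransGen (fun x y => (zdGraph 2).Adj x y ∧ x ∈ F ∧ y ∈ F) x y →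
      Relation.ReflTransGen (fun x y => (zdGraph 2).Adj x y ∧ x ∈ F ∧ y ∈ F) y x := by
    intro x y h
    induction h with
    | refl => exact Relation.ReflTransGen.refl
    | tail _ hbc ih => exact Relation.ReflTransGen.head ⟨hbc.1.symm, hbc.2.2, hbc.2.1⟩ ih
  rw [isGraphConnected_iff_reflTransGen hbase]
  intro τ hτ
  exact hsymm _ _ (key _ τ rfl hτ)

/-- **The half-disk family is large**: if all tiles `τ` with `|τ|_∞ ≤ M` are deep, it has at
least `M²` members. [folklore] -/
theorem card_halfFamily_ge (hδ : 0 < δ) {Rd M : ℕ} (G : Frame) (hz : G.z₀ = 0)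
    (hdeep : ∀ τ : Site 2, (∀ k, |τ k| ≤ M) → IsDeepTile δ m r Rd τ) : M ^ 2 ≤ (halfFamily δ m r Rd G).card := by
  classical
  obtain ⟨i, σ, hσ, hey⟩ : ∃ (i : Fin 2) (σ : ℤ), (σ = 1 ∨ σ = -1) ∧ G.ey = σ • Pi.single i 1 := by
    rcases G.valid with ⟨-, h2 | h2⟩ | ⟨-, h2 | h2⟩ | ⟨-, h2 | h2⟩ | ⟨-, h2 | h2⟩ <;> rw [h2]
    · exact ⟨1, 1, Or.inl rfl, by ext k; fin_cases k <;> simp⟩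
    · exact ⟨1, -1, Or.inr rfl, by ext k; fin_cases k <;> simp⟩
    · exact ⟨1, 1, Or.inl rfl, by ext k; fin_cases k <;> simp⟩
    · exact ⟨1, -1, Or.inr rfl, by ext k; fin_cases k <;> simp⟩
    · exact ⟨0, 1, Or.inl rfl, by ext k; fin_cases k <;> simp⟩
    · exact ⟨0, -1, Or.inr rfl, by ext k; fin_cases k <;> simp⟩
    · exact ⟨0, 1, Or.inl rfl, by ext k; fin_cases k <;> simp⟩
    · exact ⟨0, -1, Or.inr rfl, by ext k; fin_cases k <;> simp⟩
  have hfy : ∀ τ : Site 2, G.fy τ = σ * τ i := fun τ => by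
    simp only [Frame.fy, hz, Pi.zero_apply, sub_zero, hey, Pi.smul_apply, smul_eq_mul]
    fin_cases i <;> simp <;> ring
  obtain ⟨j, hji⟩ : ∃ j : Fin 2, j ≠ i := ⟨i + 1, by fin_cases i <;> decide⟩
  -- the injection `(a, b) ↦ τ` with `τ j = a`, `τ i = -σ (b + 1)`, `a, b ∈ [0, M)`
  let f : ℕ × ℕ → Site 2 := fun p => Function.update (Function.update 0 j (p.1 : ℤ)) i (-σ * (p.2 + 1))
  have hfi : ∀ p : ℕ × ℕ, f p i = -σ * (p.2 + 1) := fun p => by simp [f]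
  have hfj : ∀ p : ℕ × ℕ, f p j = p.1 := fun p => by simp [f, Function.update_of_ne hji]
  have hinj : Set.InjOn f ((Finset.range M) ×ˢ (Finset.range M) : Finset (ℕ × ℕ)) := by
    intro p _ q _ h
    have h1 := congrFun h i; have h2 := congrFun h j
    rw [hfi, hfi] at h1; rw [hfj, hfj] at h2
    rcases hσ with rfl | rfl <;> exact Prod.ext (by exact_mod_cast h2) (by push_cast at h1; omega)
  have hsub : ∀ p ∈ ((Finset.range M) ×ˢ (Finset.range M) : Finset (ℕ × ℕ)), f p ∈ halfFamily δ m r Rd G := by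
    intro p hp
    rw [Finset.mem_product, Finset.mem_range, Finset.mem_range] at hp
    rw [mem_halfFamily hδ, hfy, hfi]
    refine ⟨hdeep _ fun k => ?_, ?_⟩
    · rcases (show k = i ∨ k = j by fin_cases i <;> fin_cases j <;> fin_cases k <;> simp_all) with rfl | rfl
      · rw [hfi]; rcases hσ with rfl | rfl <;> rw [abs_le] <;> constructor <;> push_cast <;> omega
      · rw [hfj]; rw [abs_le]; constructor <;> omega
    · rcases hσ with rfl | rfl <;> nlinarith
  calc M ^ 2 = ((Finset.range M) ×ˢ (Finset.range M) : Finset (ℕ × ℕ)).card := by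
        rw [Finset.card_product, Finset.card_range, sq]
    _ ≤ (halfFamily δ m r Rd G).card := Finset.card_le_card_of_injOn f hsub hinj

/-- The base tile `-ey` is in the half-disk family if the tiles with `|τ|_∞ ≤ 1` are deep.
[folklore] -/
theorem neg_ey_mem_halfFamily (hδ : 0 < δ) {Rd M : ℕ} (hM : 1 ≤ M) (G : Frame) (hz : G.z₀ = 0)
    (hdeep : ∀ τ : Site 2, (∀ k, |τ k| ≤ M) → IsDeepTile δ m r Rd τ) : -G.ey ∈ halfFamily δ m r Rd G := by
  rw [mem_halfFamily hδ]
  refine ⟨hdeep _ fun k => ?_, ?_⟩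
  · rcases G.valid with ⟨-, h2 | h2⟩ | ⟨-, h2 | h2⟩ | ⟨-, h2 | h2⟩ | ⟨-, h2 | h2⟩ <;> rw [h2] <;>
      fin_cases k <;> simp [pt_apply_zero, pt_apply_one] <;> omega
  · simp only [Frame.fy, hz, Pi.zero_apply, sub_zero, Pi.neg_apply]
    rcases G.valid with ⟨-, h2 | h2⟩ | ⟨-, h2 | h2⟩ | ⟨-, h2 | h2⟩ | ⟨-, h2 | h2⟩ <;> simp [h2, pt_apply_zero, pt_apply_one]

end SupercriticalSAW

end Literature.Barriers.CriticalPhenomena
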